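import Mathlib
import HarnessLib
import Summits.KontsevichZagierPeriods.Zeta5Search.Denom.LineProfileShape

/-!
# The L(7/20) tale-1 line profile and its shape at `ξ = 251/5` (L(7/20) decay, one-variable side)

HONEST FRAMING: systematic search; no irrationality claim unless certified.  Elementary real analysis of one explicit function;
no statement about `ζ(2)`, `ζ(5)` or any linear form.  Cell pub-zeta5 (measure-opt g0); the L(7/20) twin of
`TwoTaleL25LineProfileShape` / P1's `TwoTaleD1LineProfileShape` (file T4).  L(7/20) is the first-tale cone point
`(127,107,87,147 | 0,20,40,254)` of [Zudilin2014ZetaTwo, §3] (rung `s = 7/20` of fam-measure g8's ladder `L(s)`).  Seen from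
`u = t − (107n+1)`, `R(t)` has numerator blocks `(0,127n]`, `(20n,107n]`, `(40n,87n]` and denominator block `(147n, 254n+1]`:
`profileL7200 ξ η = (gPrim η (ξ+20) − gPrim η (ξ−107)) + (gPrim η ξ − gPrim η (ξ−87)) + (gPrim η (ξ−20) − gPrim η (ξ−67))
− (gPrim η (ξ+147) − gPrim η (ξ+40)) + profileL720Const`, `profileL720Const = 107 log 107 − 127 log 127 − 87 log 87 − 47 log 47 + 154`,
`profileL720 = profileL7200 − 2π|η|`.  Design line `ξ = 251/5 = 50.2` (saddle `ξ* = 50.20514`, `η* = 20.6228`, value `−283.11347336`;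
on the line `sup = −283.1134718`, loss `1.4·10⁻⁶` nats).  `PL`, `DL`, `numLegsL` (legs `w ∈ {702,568,502,368,302,168}/10`),
`denAngleL = arctan(1972/(10η)) − arctan(902/(10η)) = arctan(107η/(η² + 1778744/100))`, monotone on `(0,133]`; `DL_antitoneOn`,
`DL_le_neg_four` on `[133,∞)` (`261/133 + 4 ≤ 2π`), `PL_tail`, two-point lemma `twoPointL`.  The numerical instance is
`TwoTaleL720LineCertificate.lean`.
-/

noncomputable section

open Real Set

namespace Summit.KontsevichZagierPeriods.Zeta5Search.TwoTaleL720LineProfileShape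

open Summit.KontsevichZagierPeriods.Zeta5Search.Denom.LineProfile
open Summit.KontsevichZagierPeriods.Zeta5Search.Denom.LineProfileShape (arctan_div_anti)

/-! ## The L(7/20) profile (generic abscissa `ξ`) -/

/-- The factorial constant `107 log 107 − 127 log 127 − 87 log 87 − 47 log 47 + 154` of the L(7/20)
profile. -/
def profileL720Const : ℝ :=
  107 * Real.log 107 - 127 * Real.log 127 - 87 * Real.log 87 - 47 * Real.log 47 + 154

/-- `profileL7200 ξ η`: the `2π|η|`-free part of the L(7/20) line profile at abscissa `ξ` —
numerator blocks `(ξ+20 | ξ−107)`, `(ξ | ξ−87)`, `(ξ−20 | ξ−67)`, denominator block `(ξ+147 | ξ+40)`,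
and `profileL720Const`. -/
def profileL7200 (ξ η : ℝ) : ℝ :=
  (gPrim η (ξ + 20) - gPrim η (ξ - 107)) + (gPrim η ξ - gPrim η (ξ - 87))
    + (gPrim η (ξ - 20) - gPrim η (ξ - 67)) - (gPrim η (ξ + 147) - gPrim η (ξ + 40)) + profileL720Const

/-- The L(7/20) line profile `profileL720 ξ η = profileL7200 ξ η − 2π|η|`. -/
def profileL720 (ξ η : ℝ) : ℝ := profileL7200 ξ η - 2 * Real.pi * |η|

/-- `angleL720 ξ η`: the `η`-derivative of `profileL7200 ξ` (a signed sum of eight angles). -/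
def angleL720 (ξ η : ℝ) : ℝ :=
  (Real.arctan ((ξ + 20) / η) - Real.arctan ((ξ - 107) / η))
    + (Real.arctan (ξ / η) - Real.arctan ((ξ - 87) / η))
    + (Real.arctan ((ξ - 20) / η) - Real.arctan ((ξ - 67) / η))
    - (Real.arctan ((ξ + 147) / η) - Real.arctan ((ξ + 40) / η))

/-- `profileL7200` is even in `η`. -/
theorem profileL7200_neg_eta (ξ η : ℝ) : profileL7200 ξ (-η) = profileL7200 ξ η := by
  simp only [profileL7200, gPrim_neg_eta]

/-- `profileL720` is even in `η`. -/
theorem profileL720_neg_eta (ξ η : ℝ) : profileL720 ξ (-η) = profileL720 ξ η := by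
  simp only [profileL720, profileL7200_neg_eta, abs_neg]

/-- `d/dη profileL7200 ξ η = angleL720 ξ η` for `η ≠ 0`. -/
theorem hasDerivAt_profileL7200_eta (ξ : ℝ) {η : ℝ} (hη : η ≠ 0) :
    HasDerivAt (fun η : ℝ => profileL7200 ξ η) (angleL720 ξ η) η := by
  have h := fun w => hasDerivAt_gPrim_eta hη w
  have key := (((((h (ξ + 20)).sub (h (ξ - 107))).add ((h ξ).sub (h (ξ - 87)))).add
    ((h (ξ - 20)).sub (h (ξ - 67)))).sub ((h (ξ + 147)).sub (h (ξ + 40)))).add_const profileL720Const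
  exact key

/-- `d/dη profileL720 ξ η = angleL720 ξ η − 2π` for `η > 0`. -/
theorem hasDerivAt_profileL720_eta (ξ : ℝ) {η : ℝ} (hη : 0 < η) :
    HasDerivAt (fun η : ℝ => profileL720 ξ η) (angleL720 ξ η - 2 * Real.pi) η := by
  have habs : HasDerivAt (fun η : ℝ => 2 * Real.pi * |η|) (2 * Real.pi * 1) η := by
    refine ((hasDerivAt_id' η).congr_of_eventuallyEq ?_).const_mul (2 * Real.pi)
    filter_upwards [Ioi_mem_nhds hη] with x hx using abs_of_pos hx
  have key : HasDerivAt (fun η : ℝ => profileL7200 ξ η - 2 * Real.pi * |η|)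
      (angleL720 ξ η - 2 * Real.pi * 1) η := (hasDerivAt_profileL7200_eta ξ hη.ne').sub habs
  rw [mul_one] at key
  exact key

/-- `profileL720 ξ` is continuous on `(0, ∞)`. -/
theorem continuousOn_profileL720 (ξ : ℝ) : ContinuousOn (fun η : ℝ => profileL720 ξ η) (Ioi 0) :=
  fun _ hη => (hasDerivAt_profileL720_eta ξ hη).continuousAt.continuousWithinAt

/-! ## The line `ξ = 251/5` -/

/-- `PL η = profileL720 (251/5) η`, the L(7/20) line profile on the line `ξ = 251/5`. -/
def PL (η : ℝ) : ℝ := profileL720 (251 / 5) η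

/-- `DL η = angleL720 (251/5) η − 2π` (the derivative of `PL` on `(0, ∞)`). -/
def DL (η : ℝ) : ℝ := angleL720 (251 / 5) η - 2 * Real.pi

/-- The six numerator legs `arctan (w/η)`, `w ∈ {702, 568, 502, 368, 302, 168}/10`. -/
def numLegsL (η : ℝ) : ℝ :=
  Real.arctan (702 / 10 / η) + Real.arctan (568 / 10 / η) + Real.arctan (502 / 10 / η)
    + Real.arctan (368 / 10 / η) + Real.arctan (302 / 10 / η) + Real.arctan (168 / 10 / η)

/-- The denominator angle `arctan (1972/(10η)) − arctan (902/(10η))`. -/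
def denAngleL (η : ℝ) : ℝ := Real.arctan (1972 / 10 / η) - Real.arctan (902 / 10 / η)

/-- `d/dη PL = DL` on `(0, ∞)`. -/
theorem hasDerivAt_PL {η : ℝ} (hη : 0 < η) : HasDerivAt PL (DL η) η :=
  hasDerivAt_profileL720_eta (251 / 5) hη

/-- `DL = numLegsL − denAngleL − 2π`. -/
theorem DL_eq (η : ℝ) : DL η = numLegsL η - denAngleL η - 2 * Real.pi := by
  simp only [DL, angleL720, numLegsL, denAngleL]
  have e1 : ((251 : ℝ) / 5 + 20) / η = 702 / 10 / η := by ring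
  have e2 : ((251 : ℝ) / 5 - 107) / η = -(568 / 10 / η) := by ring
  have e3 : ((251 : ℝ) / 5) / η = 502 / 10 / η := by ring
  have e4 : ((251 : ℝ) / 5 - 87) / η = -(368 / 10 / η) := by ring
  have e5 : ((251 : ℝ) / 5 - 20) / η = 302 / 10 / η := by ring
  have e6 : ((251 : ℝ) / 5 - 67) / η = -(168 / 10 / η) := by ring
  have e7 : ((251 : ℝ) / 5 + 147) / η = 1972 / 10 / η := by ring
  have e8 : ((251 : ℝ) / 5 + 40) / η = 902 / 10 / η := by ring
  rw [e1, e2, e3, e4, e5, e6, e7, e8, Real.arctan_neg, Real.arctan_neg, Real.arctan_neg]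
  ring

/-- `PL = (eight signed values of gPrim at p/10) + profileL720Const − 2π|η|`. -/
theorem PL_eq (η : ℝ) : PL η =
    gPrim η (702 / 10) + gPrim η (568 / 10) + gPrim η (502 / 10) + gPrim η (368 / 10)
      + gPrim η (302 / 10) + gPrim η (168 / 10) - gPrim η (1972 / 10) + gPrim η (902 / 10)
      + profileL720Const - 2 * Real.pi * |η| := by
  simp only [PL, profileL720, profileL7200]
  have e1 : gPrim η ((251 : ℝ) / 5 + 20) = gPrim η (702 / 10) := by norm_num
  have e2 : gPrim η ((251 : ℝ) / 5 - 107) = -gPrim η (568 / 10) := by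
    rw [show ((251 : ℝ) / 5 - 107) = -(568 / 10) by norm_num, gPrim_neg]
  have e3 : gPrim η ((251 : ℝ) / 5) = gPrim η (502 / 10) := by norm_num
  have e4 : gPrim η ((251 : ℝ) / 5 - 87) = -gPrim η (368 / 10) := by
    rw [show ((251 : ℝ) / 5 - 87) = -(368 / 10) by norm_num, gPrim_neg]
  have e5 : gPrim η ((251 : ℝ) / 5 - 20) = gPrim η (302 / 10) := by norm_num
  have e6 : gPrim η ((251 : ℝ) / 5 - 67) = -gPrim η (168 / 10) := by
    rw [show ((251 : ℝ) / 5 - 67) = -(168 / 10) by norm_num, gPrim_neg]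
  have e7 : gPrim η ((251 : ℝ) / 5 + 147) = gPrim η (1972 / 10) := by norm_num
  have e8 : gPrim η ((251 : ℝ) / 5 + 40) = gPrim η (902 / 10) := by norm_num
  rw [e1, e2, e3, e4, e5, e6, e7, e8]
  ring

/-- Closed form `denAngleL η = arctan (107η / (η² + 1778744/100))` for `η > 0` (`Real.arctan_add`). -/
theorem denAngleL_eq {η : ℝ} (hη : 0 < η) :
    denAngleL η = Real.arctan (107 * η / (η ^ 2 + 1778744 / 100)) := by
  have hη' : η ≠ 0 := hη.ne'
  unfold denAngleL
  have hx : 0 < 1972 / 10 / η := by positivity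
  have hy : 0 < 902 / 10 / η := by positivity
  have h1 : (1972 / 10 / η) * (-(902 / 10 / η)) < 1 := by nlinarith
  rw [sub_eq_add_neg, ← Real.arctan_neg, Real.arctan_add h1]
  congr 1
  have hD1 : (1 - 1972 / 10 / η * -(902 / 10 / η)) ≠ 0 := by
    have : 0 < 1 - 1972 / 10 / η * -(902 / 10 / η) := by nlinarith [mul_pos hx hy]
    exact this.ne'
  have hD2 : η ^ 2 + 1778744 / 100 ≠ 0 := by positivity
  rw [div_eq_div_iff hD1 hD2]
  field_simp
  ring

/-- `denAngleL` is monotone on `(0, 133]` (`133² = 17689 < 1778744/100`). -/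
theorem denAngleL_mono {s t : ℝ} (hs : 0 < s) (hst : s ≤ t) (ht : t ≤ 133) :
    denAngleL s ≤ denAngleL t := by
  rw [denAngleL_eq hs, denAngleL_eq (hs.trans_le hst)]
  apply Real.arctan_mono
  rw [div_le_div_iff₀ (by positivity) (by positivity)]
  have hst' : s * t ≤ 133 * 133 := mul_le_mul (hst.trans ht) ht (hs.le.trans hst) (by norm_num)
  nlinarith [mul_nonneg (sub_nonneg.2 hst) (by linarith : (0 : ℝ) ≤ 1778744 / 100 - s * t)]

/-- `DL` is antitone on `(0, 133]`. -/
theorem DL_antitoneOn {s t : ℝ} (hs : 0 < s) (hst : s ≤ t) (ht : t ≤ 133) : DL t ≤ DL s := by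
  rw [DL_eq, DL_eq]
  have hd := denAngleL_mono hs hst ht
  have l1 := arctan_div_anti (702 / 10) (by norm_num) hs hst
  have l2 := arctan_div_anti (568 / 10) (by norm_num) hs hst
  have l3 := arctan_div_anti (502 / 10) (by norm_num) hs hst
  have l4 := arctan_div_anti (368 / 10) (by norm_num) hs hst
  have l5 := arctan_div_anti (302 / 10) (by norm_num) hs hst
  have l6 := arctan_div_anti (168 / 10) (by norm_num) hs hst
  unfold numLegsL
  linarith

/-- `DL η < 0` for `η ≥ 133` (`arctan x ≤ x`, `261/133 < 2π`). -/
theorem DL_neg_of_ge {η : ℝ} (hη : 133 ≤ η) : DL η < 0 := by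
  rw [DL_eq]
  have hη0 : 0 < η := by linarith
  have hden : 0 ≤ denAngleL η := by
    unfold denAngleL
    have : Real.arctan (902 / 10 / η) ≤ Real.arctan (1972 / 10 / η) :=
      Real.arctan_mono (div_le_div_of_nonneg_right (by norm_num) hη0.le)
    linarith
  have leg : ∀ c : ℝ, 0 ≤ c → Real.arctan (c / η) ≤ c / 133 := fun c hc =>
    (show Real.arctan (c / η) ≤ c / η from by
      have ht : (0:ℝ) ≤ c / η := div_nonneg hc hη0.le
      have h0 : 0 ≤ Real.arctan (c / η) := by simpa using Real.arctan_mono ht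
      have h := Real.le_tan h0 (Real.arctan_lt_pi_div_two _)
      rwa [Real.tan_arctan] at h).trans
      (div_le_div_of_nonneg_left hc (by norm_num) hη)
  have l1 := leg (702 / 10) (by norm_num)
  have l2 := leg (568 / 10) (by norm_num)
  have l3 := leg (502 / 10) (by norm_num)
  have l4 := leg (368 / 10) (by norm_num)
  have l5 := leg (302 / 10) (by norm_num)
  have l6 := leg (168 / 10) (by norm_num)
  unfold numLegsL
  nlinarith [Real.pi_gt_three]

/-- `DL η ≤ −4` for `η ≥ 133` (`arctan x ≤ x`, `261/133 + 4 ≤ 2π`). -/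
theorem DL_le_neg_four {η : ℝ} (hη : 133 ≤ η) : DL η ≤ -4 := by
  rw [DL_eq]
  have hη0 : 0 < η := by linarith
  have hden : 0 ≤ denAngleL η := by
    unfold denAngleL
    have : Real.arctan (902 / 10 / η) ≤ Real.arctan (1972 / 10 / η) :=
      Real.arctan_mono (div_le_div_of_nonneg_right (by norm_num) hη0.le)
    linarith
  have leg : ∀ c : ℝ, 0 ≤ c → Real.arctan (c / η) ≤ c / 133 := fun c hc =>
    (show Real.arctan (c / η) ≤ c / η from by
      have ht : (0:ℝ) ≤ c / η := div_nonneg hc hη0.le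
      have h0 : 0 ≤ Real.arctan (c / η) := by simpa using Real.arctan_mono ht
      have h := Real.le_tan h0 (Real.arctan_lt_pi_div_two _)
      rwa [Real.tan_arctan] at h).trans
      (div_le_div_of_nonneg_left hc (by norm_num) hη)
  have l1 := leg (702 / 10) (by norm_num)
  have l2 := leg (568 / 10) (by norm_num)
  have l3 := leg (502 / 10) (by norm_num)
  have l4 := leg (368 / 10) (by norm_num)
  have l5 := leg (302 / 10) (by norm_num)
  have l6 := leg (168 / 10) (by norm_num)
  unfold numLegsL
  linarith [Real.pi_gt_three]

/-- Tail slope: `PL η ≤ PL 133 − 4 (η − 133)` for `η ≥ 133` (mean value theorem and `DL_le_neg_four`). -/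
theorem PL_tail {η : ℝ} (hη : 133 ≤ η) : PL η ≤ PL 133 - 4 * (η - 133) := by
  rcases hη.eq_or_lt with h | hlt
  · rw [← h]
    simp
  have cont : ContinuousOn PL (Icc 133 η) :=
    (continuousOn_profileL720 (251 / 5)).mono fun x hx => lt_of_lt_of_le (by norm_num) hx.1
  have deriv : ∀ x ∈ Ioo 133 η, HasDerivAt PL (DL x) x := fun x hx =>
    hasDerivAt_PL (lt_trans (by norm_num) hx.1)
  obtain ⟨ξ, hξ, hslope⟩ := exists_hasDerivAt_eq_slope PL DL hlt cont deriv
  have h4 : DL ξ ≤ -4 := DL_le_neg_four hξ.1.le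
  rw [hslope, div_le_iff₀ (by linarith)] at h4
  linarith

/-- **Two-point tangent lemma.**  If `0 < η₁ ≤ η₂ ≤ 133`, `0 ≤ DL η₁` and `DL η₂ ≤ 0`, then
`PL η ≤ PL η₁ + DL η₁ · (η₂ − η₁)` for every `η > 0`. -/
theorem twoPointL {η₁ η₂ : ℝ} (h1 : 0 < η₁) (h12 : η₁ ≤ η₂) (h2 : η₂ ≤ 133) (hD1 : 0 ≤ DL η₁)
    (hD2 : DL η₂ ≤ 0) {η : ℝ} (hη : 0 < η) : PL η ≤ PL η₁ + DL η₁ * (η₂ - η₁) := by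
  have cont : ∀ a b : ℝ, 0 < a → ContinuousOn PL (Icc a b) := fun a b ha =>
    (continuousOn_profileL720 (251 / 5)).mono fun x hx => lt_of_lt_of_le ha hx.1
  have diff : ∀ a b : ℝ, 0 < a → DifferentiableOn ℝ PL (interior (Icc a b)) :=
    fun a b ha x hx => by
      rw [interior_Icc] at hx
      exact (hasDerivAt_PL (ha.trans hx.1)).differentiableAt.differentiableWithinAt
  have der : ∀ x : ℝ, 0 < x → deriv PL x = DL x := fun x hx => (hasDerivAt_PL hx).deriv
  have h2pos : 0 < η₂ := h1.trans_le h12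
  -- the tangent bound on `[η₁, y]` for `y ≤ η₂`
  have mid : ∀ y : ℝ, η₁ ≤ y → y ≤ η₂ → PL y - PL η₁ ≤ DL η₁ * (y - η₁) :=
    fun y hy1 hy2 =>
    (convex_Icc η₁ y).image_sub_le_mul_sub_of_deriv_le (cont η₁ y h1) (diff η₁ y h1)
      (C := DL η₁)
      (fun x hx => by
        rw [interior_Icc] at hx
        rw [der x (h1.trans hx.1)]
        exact DL_antitoneOn h1 hx.1.le (by linarith [hx.2]))
      η₁ ⟨le_rfl, hy1⟩ y ⟨hy1, le_rfl⟩ hy1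
  rcases le_total η η₁ with hle | hge
  · have mono : MonotoneOn PL (Icc η η₁) :=
      monotoneOn_of_deriv_nonneg (convex_Icc η η₁) (cont η η₁ hη) (diff η η₁ hη) fun x hx => by
        rw [interior_Icc] at hx
        rw [der x (hη.trans hx.1)]
        exact hD1.trans (DL_antitoneOn (hη.trans hx.1) hx.2.le (h12.trans h2))
    have := mono ⟨le_rfl, hle⟩ ⟨hle, le_rfl⟩ hle
    nlinarith [mul_nonneg hD1 (sub_nonneg.2 h12)]
  · rcases le_total η η₂ with hle2 | hge2
    · have := mid η hge hle2
      nlinarith [mul_le_mul_of_nonneg_left (by linarith : η - η₁ ≤ η₂ - η₁) hD1]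
    · have anti : AntitoneOn PL (Icc η₂ η) :=
        antitoneOn_of_deriv_nonpos (convex_Icc η₂ η) (cont η₂ η h2pos) (diff η₂ η h2pos)
          fun x hx => by
            rw [interior_Icc] at hx
            rw [der x (h2pos.trans hx.1)]
            rcases le_or_gt x 133 with hx13 | hx13
            · exact (DL_antitoneOn h2pos hx.1.le hx13).trans hD2
            · exact (DL_neg_of_ge hx13.le).le
      have hA := anti ⟨le_rfl, hge2⟩ ⟨hge2, le_rfl⟩ hge2
      have := mid η₂ h12 le_rfl
      linarith

end Summit.KontsevichZagierPeriods.Zeta5Search.TwoTaleL720LineProfileShape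

end
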